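import Summits.HodgeConjecture.CorCM.GenericSexticThreefoldTimesCMHodge
import Summits.HodgeConjecture.CorCM.SexticCMFieldPairFlip
import Literature.AlgebraicGeometry.Pohlmann1968.CMFamilyRankPartitionSlots
import Literature.AlgebraicGeometry.Pohlmann1968.SimpleCMAbelianFourfoldPowers
import Literature.AlgebraicGeometry.Pohlmann1968.SeparatingCMFamilies
import HarnessLib

/-!
# A CM abelian variety whose CM field has PAIR FLIPS (every generic CM field, any degree) times ANY CM abelian variety
# whose Galois closure does not contain the first one's: `Hg(A₀ × A₁) = Hg(A₀) × Hg(A₁)` iff the partner is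
# nondegenerate — in particular a generic CM threefold times a simple CM FOURFOLD off its closure

COR-CM (cell `pub-hodgecm2`, binder seat `b16` gen 44, count-neutral claim CM-DIMLE3-INTRINSIC, file F4 — first step past the
factor bound `dim ≤ 3`; theorems only, no definition, no named fact, no `sorry`).  NEW as stated, hence under `Summits/`.
HONEST FRAMING: an unconditional theorem on pairs of CM abelian varieties; not a step of the summit chain (`HC_CM` is neither
used nor advanced).

SETTING.  `K_{i₁}` is a CM field with PAIR FLIPS: every conjugate pair of complex embeddings is exchanged by an automorphism
of `ℂ` fixing all the other embeddings (the generic CM fields of every degree `2g`, Galois group `C₂ ≀ 𝔖_g`; for `g = 3`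
exactly the sextic CM fields with Galois closure of degree `24` or `48`, `CorCM/SexticCMFieldPairFlip`).  Then for every
type `Φ_{i₁}` the character module `U(Φ_{i₁})` of the Hodge group is IRREDUCIBLE of dimension `g` and `Φ_{i₁}` is
nondegenerate (seat b16 gen 41, `irreducible_and_finrank_eq_of_pairFlip`).  The partner `K_{i₀}` is ANY CM field whose
Galois closure `L_{i₀} ≤ ℂ` does NOT contain `L_{i₁}` — e.g. `[L_{i₀} : ℚ] < [L_{i₁} : ℚ]`, or `L_{i₀} ≠ L_{i₁}` of the same
degree.  Seat b16 gen 43's criterion (κ) for CM fields (`pairwise_of_irreducible_of_not_normalClosure_le`: an automorphism of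
`ℂ` fixing `L_{i₀}` pointwise moves an irreducible `U(Φ_{i₁})`) gives NO COMMON CONSTITUENT in both orders, whence

* §1 **`isNondegenerateFamily_iff_pairFlip_of_not_normalClosure_le`** — the family `(Φ_{i₀}, Φ_{i₁})` is nondegenerate
  (`Hg(A₀ × A₁) = Hg(A₀) × Hg(A₁)`, `B• = D•` on all `A₀^a × A₁^b`) **iff `Φ_{i₀}` is nondegenerate**; degree form
  `…_of_finrank_normalClosure_lt`.  Seat b16 gen 41 (`CorCM/GenericSexticThreefoldTimesCMHodge`) had the partners of degree
  `≤ 4` and the sextic partners through an imaginary quadratic field with NO closure condition; gen 43 the partners of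
  dimension `≤ 3` with a different closure; here the partner has ANY degree.
* §2 on abelian varieties: **`hodgeConjectureFor_prod_pairFlip_of_not_normalClosure_le`** (the Hodge conjecture and
  `B• = D•` on every `⨁_{j<N} A_{π j}` when `Φ_{i₀}` is nondegenerate, UNCONDITIONALLY); for SIMPLE, non-isogenous
  realisations **`forall_prod_hodgeClassSpan_eq_iff_pairFlip_of_not_normalClosure_le`** (`B• = D•` on ALL products iff
  `Φ_{i₀}` is nondegenerate, else an exceptional class).
* §3 THE FIRST `(3, 4)` CELL OF DIMENSION `7`: **`forall_prod_isDivisorGenerated_iff_threefold_fourfold_of_not_normalClosure_le`**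
  — a simple CM THREEFOLD `T` with a pair-flip sextic field times a simple CM FOURFOLD `F` whose octic field has Galois
  closure not containing `L_T` (e.g. of degree `8` or `16`, or any degree not divisible by `3`): `B• = D•` on all
  `T^a × F^b` IFF `F` itself is divisor-generated (iff `F` carries no Weil classes, Moonen–Zarhin (0.1) (b)); then the Hodge
  conjecture on all `T^a × F^b`, UNCONDITIONALLY.  WHAT IS LEFT at `(3, 4)` (successor note, not formalised): `L_T ≤ L_F`,
  i.e. the octic field inside the closure of the sextic one — for the generic sextic field (`[L_T:ℚ] = 48 = |C₂ × 𝔖₄|`) the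
  reflex field `K_T^r` is such an octic field, `U(Φ_F) ⊇ U(Φ_T)` for every nondegenerate type of `K_T^r`, and the pair is
  degenerate for exactly one isogeny class of nondegenerate simple fourfolds `F` per `T` (the odd parts of `ℚ[C₂³]` and of
  the signed permutation module share the reflection representation).

## References

* [Gordon1999HodgeAVSurvey] B. B. Gordon, *A survey of the Hodge conjecture for abelian varieties*, §3 Theorem, 7.4–7.7,
  9.4, 10.10.
* [Dodson1984] B. Dodson, *The structure of Galois groups of CM-fields*, Trans. AMS 283 (1984), §1.1, §3.3.2, §5.1.2.
* [MoonenZarhin1999LowDim] B. Moonen, Yu. Zarhin, *Hodge classes on abelian varieties of low dimension*, Math. Ann. 315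
  (1999), Thm. (0.1) (b), (2.4)–(2.5).
* [Lang2002] S. Lang, *Algebra*, GTM 211, V §1 Prop. 1.2, VI §1 Thm. 1.1.
-/

noncomputable section

open CategoryTheory CategoryTheory.Limits NumberField Module IntermediateField

namespace Summit.HodgeConjecture.CorCM

open Literature.NumberTheory.ComplexMultiplication
open Literature.AlgebraicGeometry.Motives (AbelianVariety CMType)
open Literature.AlgebraicGeometry.HodgeTheory
open Literature.AlgebraicGeometry.ComplexMultiplication (IsCMTypeRealisation isSimple_iff_isPrimitive)
open Literature.AlgebraicGeometry.VanGeemen1994 (hodgeClassSpan)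
open Literature.AlgebraicGeometry.Pohlmann1968
open Literature.Barriers.HodgeConjecture (divisorClassesSpan)

variable {I : Type} {K : I → Type} [∀ i, Field (K i)] [∀ i, NumberField (K i)] [∀ i, IsCMField (K i)] [Fintype I]
  [DecidableEq I] {Φ : ∀ i, CMType (K i)}

/-! ## §1 Types: the pair is nondegenerate iff the partner type is -/

section Types

variable [Nonempty I]

/-- **A pair-flip CM field times ANY CM field whose Galois closure does not contain the first one's: the family of types is
nondegenerate iff the partner type is.**  `U(Φ_{i₁})` is irreducible and `Φ_{i₁}` nondegenerate (pair flips); an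
automorphism of `ℂ` fixing `L_{i₀}` pointwise moves some embedding of `K_{i₁}` (`L_{i₁} ⊄ L_{i₀}`), so the two slots share no
constituent in either order (criterion (κ)), and nondegeneracy is decided slot by slot.
[cite: Gordon1999HodgeAVSurvey, §3 Theorem and 7.5–7.7] [cite: Dodson1984, §1.1 and §5.1.2] -/
theorem isNondegenerateFamily_iff_pairFlip_of_not_normalClosure_le {i₀ i₁ : I} (h01 : i₀ ≠ i₁)
    (hI : ∀ j, j = i₀ ∨ j = i₁)
    (hflip : ∀ s : K i₁ →+* ℂ, ∃ σ : ℂ ≃+* ℂ, σ • s = (starRingAut : ℂ ≃+* ℂ) • s ∧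
      ∀ t : K i₁ →+* ℂ, t ≠ s → t ≠ (starRingAut : ℂ ≃+* ℂ) • s → σ • t = t)
    (hL : ¬ normalClosure ℚ (K i₁) ℂ ≤ normalClosure ℚ (K i₀) ℂ) :
    CMAlgebra.IsNondegenerateFamily Φ ↔ IsNondegenerate (Φ i₀) := by
  obtain ⟨hirr, -, hnd₁⟩ := irreducible_and_finrank_eq_of_pairFlip (Φ := Φ) hflip
  have hp := pairwise_of_irreducible_of_not_normalClosure_le (Φ := Φ) (i := i₁) (j := i₀) hirr hnd₁ hL
  rw [isNondegenerateFamily_iff_forall_of_pairwise Φ fun i j hij => ?_]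
  · exact ⟨fun h => h i₀, fun h i => by rcases hI i with rfl | rfl <;> assumption⟩
  · rcases hI i with rfl | rfl <;> rcases hI j with rfl | rfl
    · exact absurd rfl hij
    · exact hp.2
    · exact hp.1
    · exact absurd rfl hij

/-- **Degree form**: a pair-flip CM field times any CM field with a Galois closure of SMALLER degree — nondegenerate iff
the partner type is (a closure of larger degree is not contained in one of smaller degree).  E.g. a generic sextic CM field
(`[L:ℚ] ∈ {24, 48}`) against any CM field whose closure has degree `< 24`: every CM field of degree `≤ 4`, every Galois
CM field of degree `≤ 22`, every octic CM field with closure of degree `8` or `16`.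
[cite: Gordon1999HodgeAVSurvey, §3 Theorem and 7.5–7.7] [cite: Lang2002, V §1 Prop. 1.2] -/
theorem isNondegenerateFamily_iff_pairFlip_of_finrank_normalClosure_lt {i₀ i₁ : I} (h01 : i₀ ≠ i₁)
    (hI : ∀ j, j = i₀ ∨ j = i₁)
    (hflip : ∀ s : K i₁ →+* ℂ, ∃ σ : ℂ ≃+* ℂ, σ • s = (starRingAut : ℂ ≃+* ℂ) • s ∧
      ∀ t : K i₁ →+* ℂ, t ≠ s → t ≠ (starRingAut : ℂ ≃+* ℂ) • s → σ • t = t)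
    (hlt : finrank ℚ ↥(normalClosure ℚ (K i₀) ℂ) < finrank ℚ ↥(normalClosure ℚ (K i₁) ℂ)) :
    CMAlgebra.IsNondegenerateFamily Φ ↔ IsNondegenerate (Φ i₀) :=
  isNondegenerateFamily_iff_pairFlip_of_not_normalClosure_le h01 hI hflip (not_normalClosure_le_of_lt_finrank hlt)

/-- **Sextic form by the closure degree**: a sextic CM field with Galois closure of degree `24` or `48` has pair flips
(`CorCM/SexticCMFieldPairFlip`), so against ANY CM field whose closure does not contain it the pair of types is
nondegenerate iff the partner type is. [cite: Dodson1984, §5.1.2 Theorem] [cite: Gordon1999HodgeAVSurvey, 7.5–7.7] -/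
theorem isNondegenerateFamily_iff_genericSextic_of_not_normalClosure_le {i₀ i₁ : I} (h01 : i₀ ≠ i₁)
    (hI : ∀ j, j = i₀ ∨ j = i₁) (h6 : finrank ℚ (K i₁) = 6)
    (h48 : finrank ℚ ↥(normalClosure ℚ (K i₁) ℂ) = 24 ∨ finrank ℚ ↥(normalClosure ℚ (K i₁) ℂ) = 48)
    (hL : ¬ normalClosure ℚ (K i₁) ℂ ≤ normalClosure ℚ (K i₀) ℂ) :
    CMAlgebra.IsNondegenerateFamily Φ ↔ IsNondegenerate (Φ i₀) := by
  haveI : NumberField ↥(normalClosure ℚ (K i₁) ℂ) := NumberField.mk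
  haveI : IsNormalClosure ℚ (K i₁) ↥(normalClosure ℚ (K i₁) ℂ) :=
    Algebra.IsAlgebraic.isNormalClosure_normalClosure fun x => IsAlgClosed.splits _
  exact isNondegenerateFamily_iff_pairFlip_of_not_normalClosure_le h01 hI
    (GenericCMField.pairFlip_of_finrank_normalClosure h6 _ h48) hL

end Types

/-! ## §2 Abelian varieties -/

section Geometry

variable [Nonempty I] {A : I → AbelianVariety ℂ} {ι : ∀ i, 𝓞 (K i) →+* End (A i)}
  {θ : ∀ i, K i →+* Module.End ℂ (complexBetti (A i).X 1)}

/-- **The Hodge conjecture on every `A₀^a × A₁^b`** (every `⨁_{j<N} A_{π j}`), with `B• = D•` there, for realisations of a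
NONDEGENERATE type `Φ_{i₀}` of any CM field and any type of a pair-flip CM field whose Galois closure is not contained in
`L_{i₀}` — UNCONDITIONAL. [cite: Gordon1999HodgeAVSurvey, §3 Theorem, 7.5 and 10.10] -/
theorem hodgeConjectureFor_prod_pairFlip_of_not_normalClosure_le {i₀ i₁ : I} (h01 : i₀ ≠ i₁)
    (hI : ∀ j, j = i₀ ∨ j = i₁)
    (hflip : ∀ s : K i₁ →+* ℂ, ∃ σ : ℂ ≃+* ℂ, σ • s = (starRingAut : ℂ ≃+* ℂ) • s ∧
      ∀ t : K i₁ →+* ℂ, t ≠ s → t ≠ (starRingAut : ℂ ≃+* ℂ) • s → σ • t = t)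
    (hL : ¬ normalClosure ℚ (K i₁) ℂ ≤ normalClosure ℚ (K i₀) ℂ) (hnd : IsNondegenerate (Φ i₀))
    (hA : ∀ i, IsCMTypeRealisation (Φ i) (A i) (ι i) (θ i)) {N : ℕ} (π : Fin N → I) :
    HodgeConjectureFor (⨁ fun j : Fin N => A (π j)).dim (⨁ fun j : Fin N => A (π j)).X ∧
      ∀ m : ℕ, hodgeClassSpan (⨁ fun j : Fin N => A (π j)).dim (⨁ fun j : Fin N => A (π j)).X m =
        divisorClassesSpan (⨁ fun j : Fin N => A (π j)).X (⨁ fun j : Fin N => A (π j)).dim m :=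
  have h := (isNondegenerateFamily_iff_pairFlip_of_not_normalClosure_le h01 hI hflip hL).2 hnd
  ⟨h.hodgeConjectureFor_prod hA π, fun m => h.hodgeClassSpan_prod_eq_divisorClassesSpan hA π m⟩

/-- **`B• = D•` on ALL `A₀^a × A₁^b` iff the partner type is nondegenerate**, for SIMPLE, non-isogenous realisations (a
separating family): otherwise some product carries an exceptional Hodge class (Hazama–Murty).
[cite: Gordon1999HodgeAVSurvey, 7.5 (1) ⟺ (3) and 7.6.1] -/
theorem forall_prod_hodgeClassSpan_eq_iff_pairFlip_of_not_normalClosure_le {i₀ i₁ : I} (h01 : i₀ ≠ i₁)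
    (hI : ∀ j, j = i₀ ∨ j = i₁)
    (hflip : ∀ s : K i₁ →+* ℂ, ∃ σ : ℂ ≃+* ℂ, σ • s = (starRingAut : ℂ ≃+* ℂ) • s ∧
      ∀ t : K i₁ →+* ℂ, t ≠ s → t ≠ (starRingAut : ℂ ≃+* ℂ) • s → σ • t = t)
    (hL : ¬ normalClosure ℚ (K i₁) ℂ ≤ normalClosure ℚ (K i₀) ℂ)
    (hA : ∀ i, IsCMTypeRealisation (Φ i) (A i) (ι i) (θ i)) (hS : ∀ i, (A i).IsSimple)
    (hniso : ∀ i j, i ≠ j → ¬ AbelianVariety.IsIsogenous (A i) (A j)) :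
    (∀ (N : ℕ) (π : Fin N → I) (m : ℕ),
      hodgeClassSpan (⨁ fun j : Fin N => A (π j)).dim (⨁ fun j : Fin N => A (π j)).X m =
        divisorClassesSpan (⨁ fun j : Fin N => A (π j)).X (⨁ fun j : Fin N => A (π j)).dim m) ↔
      IsNondegenerate (Φ i₀) := by
  constructor
  · intro h
    by_contra hdeg
    have hfam : ¬ CMAlgebra.IsNondegenerateFamily Φ := fun hf =>
      hdeg ((isNondegenerateFamily_iff_pairFlip_of_not_normalClosure_le h01 hI hflip hL).1 hf)
    obtain ⟨N, π, m, c, hcQ, hcH, hcD⟩ := CMAlgebra.exists_exceptional_prod_of_not_isNondegenerateFamily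
      (CMAlgebra.isSeparatingFamily_of_isSimple_of_pairwise_not_isIsogenous hA hS hniso) hfam hA
    exact hcD (by rw [← h N π m]; exact Submodule.subset_span ⟨hcQ, hcH⟩)
  · intro hnd N π m
    exact ((hodgeConjectureFor_prod_pairFlip_of_not_normalClosure_le h01 hI hflip hL hnd hA π).2 m)

end Geometry

/-! ## §3 A simple CM threefold with a pair-flip field times a simple CM fourfold off its closure -/

section ThreefoldFourfold

variable [Nonempty I] {A : I → AbelianVariety ℂ} {ι : ∀ i, 𝓞 (K i) →+* End (A i)}
  {θ : ∀ i, K i →+* Module.End ℂ (complexBetti (A i).X 1)}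

/-- **THE `(3, 4)` CELL OFF THE CLOSURE.**  Let `T = A_{i₁}` be a CM threefold with CM by a sextic field with pair flips and
`F = A_{i₀}` a SIMPLE CM abelian fourfold (realisation of a type of an octic CM field) whose Galois closure does not contain
`L_T`.  Then the family `(Φ_F, Φ_T)` is nondegenerate — `Hg(T × F) = Hg(T) × Hg(F)` — IFF `F` is divisor-generated
(`B•(F) = D•(F)`; iff `Φ_F` is nondegenerate, iff `F` carries no Weil classes: the simple-fourfold criterion of
`Pohlmann1968/SimpleCMAbelianFourfoldPowers`). [cite: MoonenZarhin1999LowDim, Thm. (0.1) (b) and (2.4)–(2.5)]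
[cite: Gordon1999HodgeAVSurvey, 5.13, 7.5–7.7] [cite: Dodson1984, §5.1.2 Theorem] -/
theorem isNondegenerateFamily_iff_isDivisorGenerated_threefold_fourfold {i₀ i₁ : I} (h01 : i₀ ≠ i₁)
    (hI : ∀ j, j = i₀ ∨ j = i₁)
    (hflip : ∀ s : K i₁ →+* ℂ, ∃ σ : ℂ ≃+* ℂ, σ • s = (starRingAut : ℂ ≃+* ℂ) • s ∧
      ∀ t : K i₁ →+* ℂ, t ≠ s → t ≠ (starRingAut : ℂ ≃+* ℂ) • s → σ • t = t)
    (hL : ¬ normalClosure ℚ (K i₁) ℂ ≤ normalClosure ℚ (K i₀) ℂ) (h8 : finrank ℚ (K i₀) = 8)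
    (hA : ∀ i, IsCMTypeRealisation (Φ i) (A i) (ι i) (θ i)) (hF : (A i₀).IsSimple) :
    CMAlgebra.IsNondegenerateFamily Φ ↔ IsDivisorGenerated (A i₀) := by
  obtain ⟨φ₀⟩ : Nonempty (K i₀ →+* ℂ) := inferInstance
  rw [isNondegenerateFamily_iff_pairFlip_of_not_normalClosure_le h01 hI hflip hL,
    isDivisorGenerated_iff_isNondegenerate_of_finrank_eq_eight h8 φ₀ ((isSimple_iff_isPrimitive (hA i₀) φ₀).1 hF) (hA i₀)]

/-- **`B• = D•` on ALL `T^a × F^b` iff `B•(F) = D•(F)`**, for a SIMPLE CM threefold `T` with a pair-flip sextic field and a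
SIMPLE CM fourfold `F` whose Galois closure does not contain `L_T` (the two are not isogenous: different dimensions); in the
degenerate case some `T^a × F^b` carries an exceptional Hodge class — indeed already `F` does.
[cite: MoonenZarhin1999LowDim, Thm. (0.1) (b)] [cite: Gordon1999HodgeAVSurvey, 7.5 and 7.6.1] -/
theorem forall_prod_isDivisorGenerated_iff_threefold_fourfold_of_not_normalClosure_le {i₀ i₁ : I} (h01 : i₀ ≠ i₁)
    (hI : ∀ j, j = i₀ ∨ j = i₁)
    (hflip : ∀ s : K i₁ →+* ℂ, ∃ σ : ℂ ≃+* ℂ, σ • s = (starRingAut : ℂ ≃+* ℂ) • s ∧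
      ∀ t : K i₁ →+* ℂ, t ≠ s → t ≠ (starRingAut : ℂ ≃+* ℂ) • s → σ • t = t)
    (hL : ¬ normalClosure ℚ (K i₁) ℂ ≤ normalClosure ℚ (K i₀) ℂ) (h6 : finrank ℚ (K i₁) = 6)
    (h8 : finrank ℚ (K i₀) = 8) (hA : ∀ i, IsCMTypeRealisation (Φ i) (A i) (ι i) (θ i))
    (hS : ∀ i, (A i).IsSimple) :
    (∀ (N : ℕ) (π : Fin N → I), IsDivisorGenerated (⨁ fun j : Fin N => A (π j))) ↔ IsDivisorGenerated (A i₀) := by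
  -- the two simple members have different dimensions, hence are not isogenous: a separating family
  have hdim : ∀ i, finrank ℚ (K i) = 2 * (A i).dim := fun i => finrank_eq_two_mul_dim_of_isCMTypeRealisation (hA i)
  have hniso : ∀ i j, i ≠ j → ¬ AbelianVariety.IsIsogenous (A i) (A j) := by
    have h0 := hdim i₀
    have h1 := hdim i₁
    rw [h8] at h0
    rw [h6] at h1
    intro i j hij ⟨g, hg⟩
    have hd := AbelianVariety.dim_eq_of_isIsogeny hg
    rcases hI i with rfl | rfl <;> rcases hI j with rfl | rfl
    · exact hij rfl
    · omega
    · omega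
    · exact hij rfl
  obtain ⟨φ₀⟩ : Nonempty (K i₀ →+* ℂ) := inferInstance
  have hcrit := isDivisorGenerated_iff_isNondegenerate_of_finrank_eq_eight h8 φ₀
    ((isSimple_iff_isPrimitive (hA i₀) φ₀).1 (hS i₀)) (hA i₀)
  constructor
  · intro h
    -- `F = ⨁_{j<1} A_{i₀}` up to the obvious isomorphism: use the product over the constant map `Fin 1 → I`
    by_contra hF
    have hdeg : ¬ IsNondegenerate (Φ i₀) := fun hnd => hF (hcrit.2 hnd)
    have hfam : ¬ CMAlgebra.IsNondegenerateFamily Φ := fun hf =>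
      hdeg ((isNondegenerateFamily_iff_pairFlip_of_not_normalClosure_le h01 hI hflip hL).1 hf)
    obtain ⟨N, π, m, c, hcQ, hcH, hcD⟩ := CMAlgebra.exists_exceptional_prod_of_not_isNondegenerateFamily
      (CMAlgebra.isSeparatingFamily_of_isSimple_of_pairwise_not_isIsogenous hA hS hniso) hfam hA
    exact hcD (h N π m c hcQ hcH)
  · intro hF N π m c hcQ hcH
    have hnd : CMAlgebra.IsNondegenerateFamily Φ :=
      (isNondegenerateFamily_iff_pairFlip_of_not_normalClosure_le h01 hI hflip hL).2 (hcrit.1 hF)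
    rw [← hnd.hodgeClassSpan_prod_eq_divisorClassesSpan hA π m]
    exact Submodule.subset_span ⟨hcQ, hcH⟩

/-- **The Hodge conjecture on every `T^a × F^b`** for a CM threefold `T` with a pair-flip sextic field and a simple CM
FOURFOLD `F` off its closure which is divisor-generated (no Weil classes) — with `B• = D•` there, UNCONDITIONALLY.  The
first cell of the `(3, 4)` partition of dimension `7`. [cite: MoonenZarhin1999LowDim, Thm. (0.1) (b) and (4)]
[cite: Gordon1999HodgeAVSurvey, 10.10] -/
theorem hodgeConjectureFor_prod_threefold_fourfold_of_not_normalClosure_le {i₀ i₁ : I} (h01 : i₀ ≠ i₁)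
    (hI : ∀ j, j = i₀ ∨ j = i₁)
    (hflip : ∀ s : K i₁ →+* ℂ, ∃ σ : ℂ ≃+* ℂ, σ • s = (starRingAut : ℂ ≃+* ℂ) • s ∧
      ∀ t : K i₁ →+* ℂ, t ≠ s → t ≠ (starRingAut : ℂ ≃+* ℂ) • s → σ • t = t)
    (hL : ¬ normalClosure ℚ (K i₁) ℂ ≤ normalClosure ℚ (K i₀) ℂ) (h8 : finrank ℚ (K i₀) = 8)
    (hA : ∀ i, IsCMTypeRealisation (Φ i) (A i) (ι i) (θ i)) (hF : (A i₀).IsSimple) (hFD : IsDivisorGenerated (A i₀))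
    {N : ℕ} (π : Fin N → I) :
    HodgeConjectureFor (⨁ fun j : Fin N => A (π j)).dim (⨁ fun j : Fin N => A (π j)).X ∧
      ∀ m : ℕ, hodgeClassSpan (⨁ fun j : Fin N => A (π j)).dim (⨁ fun j : Fin N => A (π j)).X m =
        divisorClassesSpan (⨁ fun j : Fin N => A (π j)).X (⨁ fun j : Fin N => A (π j)).dim m :=
  have h := (isNondegenerateFamily_iff_isDivisorGenerated_threefold_fourfold h01 hI hflip hL h8 hA hF).2 hFD
  ⟨h.hodgeConjectureFor_prod hA π, fun m => h.hodgeClassSpan_prod_eq_divisorClassesSpan hA π m⟩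

/-- **Closure-degree form of the `(3, 4)` cell**: `T` a CM threefold whose sextic field has Galois closure of degree `24`
or `48`, `F` a simple CM fourfold whose octic field has Galois closure of degree `< 24` (degree `8`: abelian octic
fields; degree `16`) and no Weil classes: the Hodge conjecture on every `T^a × F^b`, UNCONDITIONALLY.
[cite: MoonenZarhin1999LowDim, Thm. (0.1) (b)] [cite: Dodson1984, §3.3.2 and §5.1.2] [cite: Gordon1999HodgeAVSurvey, 10.10] -/
theorem hodgeConjectureFor_prod_threefold_fourfold_of_finrank_normalClosure_lt {i₀ i₁ : I} (h01 : i₀ ≠ i₁)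
    (hI : ∀ j, j = i₀ ∨ j = i₁) (h6 : finrank ℚ (K i₁) = 6)
    (h48 : finrank ℚ ↥(normalClosure ℚ (K i₁) ℂ) = 24 ∨ finrank ℚ ↥(normalClosure ℚ (K i₁) ℂ) = 48)
    (hlt : finrank ℚ ↥(normalClosure ℚ (K i₀) ℂ) < 24) (h8 : finrank ℚ (K i₀) = 8)
    (hA : ∀ i, IsCMTypeRealisation (Φ i) (A i) (ι i) (θ i)) (hF : (A i₀).IsSimple) (hFD : IsDivisorGenerated (A i₀))
    {N : ℕ} (π : Fin N → I) :
    HodgeConjectureFor (⨁ fun j : Fin N => A (π j)).dim (⨁ fun j : Fin N => A (π j)).X ∧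
      ∀ m : ℕ, hodgeClassSpan (⨁ fun j : Fin N => A (π j)).dim (⨁ fun j : Fin N => A (π j)).X m =
        divisorClassesSpan (⨁ fun j : Fin N => A (π j)).X (⨁ fun j : Fin N => A (π j)).dim m := by
  haveI : NumberField ↥(normalClosure ℚ (K i₁) ℂ) := NumberField.mk
  haveI : IsNormalClosure ℚ (K i₁) ↥(normalClosure ℚ (K i₁) ℂ) :=
    Algebra.IsAlgebraic.isNormalClosure_normalClosure fun x => IsAlgClosed.splits _
  exact hodgeConjectureFor_prod_threefold_fourfold_of_not_normalClosure_le h01 hI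
    (GenericCMField.pairFlip_of_finrank_normalClosure h6 _ h48)
    (not_normalClosure_le_of_lt_finrank (K := K) (by omega)) h8 hA hF hFD π

end ThreefoldFourfold

end Summit.HodgeConjecture.CorCM

end
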